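import Literature.AlgebraicGeometry.HodgeTheory.ArapuraSurfaceFibredFourfoldsSplitRelativeDivisors
import Literature.AlgebraicGeometry.Motives.JacobianFiniteIndex
import Literature.AlgebraicGeometry.HodgeTheory.VanishingCohomologyNontrivialProofs
import Literature.Topology.FourManifolds.ComplexProjectiveSpaceCohomology
import HarnessLib

/-!
# Supported classes are supported on irreducible subvarieties; the classes supported on one
# subvariety of dimension `d` in degree `2(n - d)` form a line

Topic `Literature/AlgebraicGeometry/HodgeTheory` (family `hodge`). Theorems only (no definition, no
named fact; D-0026).

For `X` smooth projective of dimension `n` over `ℂ`, the coniveau space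
`supportedClasses X i r = Nʳ Hⁱ(X(ℂ); ℂ)` is the span of the kernels
`K_Z = ker (Hⁱ(X(ℂ)) → Hⁱ((X ∖ Z)(ℂ)))` over the Zariski-closed `Z ⊆ X` of codimension `≥ r`
(`AlgebraicClasses`). With Deligne's description of `K_Z` by Gysin images of desingularised
components (Hodge III, Cor. 8.2.8 — the tree's theorem
`Deligne1974_ker_restrictCompl_eq_iSup_range_complexGysin_holds_of
Deligne1974_ker_pullback_eq_ker_pullback_resolution_holds`) and Hironaka
(`Resolution.Hironaka1964_projective_holds`) we record:

* `exists_resolution_ker_restrictCompl_eq` — for an IRREDUCIBLE closed `Z ⊆ X` there are a smooth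
  projective `Y` of dimension `dim Z` and `g : Y ⟶ X` with `g(Y) = Z` and
  `K_Z = Σ_a im (g_* : Hᵃ(Y(ℂ)) → Hᵇ(X(ℂ)))` in every degree `b` (`a + 2n = b + 2 dim Z`);
* `ker_restrictCompl_eq_bot_of_lt` — hence `K_Z = 0` in degrees `b < 2 codim Z`, and
  `finrank_ker_restrictCompl_le_one` — **`dim K_Z ≤ 1` in degree `b = 2 codim Z`** (`K_Z` is the
  image of `H⁰(Y(ℂ); ℂ) = ℂ`, i.e. the line of the cycle class of `Z`; Fulton, Lemma 19.1.1);
* `mem_iSup_ker_restrictCompl_irreducible` and `supportedClasses_eq_iSup_irreducible` —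
  **`Nʳ Hⁱ = Σ_{Z irreducible, codim ≥ r} K_Z`** (`r ≥ 1`): a class dying off `Z` is a sum of
  Gysin images from resolutions of the components of `Z`, each dying off its own component;
* `top_eq_iSup_ker_restrictCompl_of_pg_zero` — on a smooth projective SURFACE with `p_g = 0`,
  `H²(X(ℂ); ℂ) = Σ_{Z ⊆ X irreducible closed, codim ≥ 1} K_Z` (with the tree's Lefschetz `(1,1)`,
  `algebraicClasses_one_eq_top_of_pg_zero lefschetzOneOne_rational_holds`), where by the above
  `K_Z = 0` for a closed point and `dim K_Z ≤ 1` for a curve — the fibrewise input of Arapura's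
  Cor. 1.5 ("choose divisors `Z_i ⊂ X_y` (`p_g = 0`, Lefschetz `(1,1)`) whose classes span
  `H²(X_y, ℚ)`") in the form consumed by the tree's witness families: it suffices to realise, for
  every irreducible curve `Z ⊂ X_y`, ONE non-zero class supported on `Z`.

## References

* [DeligneHodgeIII1974] P. Deligne, Théorie de Hodge III, Publ. Math. IHÉS 44 (1974), Cor. 8.2.8.
* [Fulton1998] W. Fulton, Intersection Theory, 2nd ed. (1998), §19.1, Lemma 19.1.1.
* [Arapura2022] D. Arapura, Hodge cycles and the Leray filtration, Pacific J. Math. 319 (2022),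
  proof of Cor. 1.5 (p. 5).
* [VoisinHodgeI2002] C. Voisin, Hodge Theory and Complex Algebraic Geometry I (2002), Thm. 11.30.
* [Kollar2007] J. Kollár, Lectures on Resolution of Singularities (2007), Thm. 3.27.
-/

noncomputable section

open CategoryTheory AlgebraicGeometry
open Literature.AlgebraicTopology.SingularHomology

namespace Literature.AlgebraicGeometry.HodgeTheory

section HodgeTheory

variable {n : ℕ} {X : Motives.SchemeOver ℂ}

/-! ### One irreducible support: the kernel is a Gysin image from a resolution -/

/-- **Deligne's Cor. 8.2.8 for one irreducible support, with Hironaka.** For `X` smooth projective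
of dimension `n` and `Z ⊆ X` irreducible and closed, there are `d`, a smooth projective `Y` of
dimension `d = dim Z` (the height of the generic point of `Z`) and `g : Y ⟶ X` with `g(Y) = Z` such
that `ker (Hᵇ(X(ℂ)) → Hᵇ((X ∖ Z)(ℂ))) = Σ_{a + 2n = b + 2d} im g_*` in every degree `b` (the
resolution `Y → Z_red ↪ X` of Kollár's Thm. 3.27; the Gysin morphisms relative to any orientation
family). [cite: DeligneHodgeIII1974, Cor. 8.2.8] [cite: Kollar2007, Thm. 3.27] -/
theorem exists_resolution_ker_restrictCompl_eq (hX : Motives.IsSmoothProjective n X)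
    (μ : OrientationFamily) (hμ : μ.HasPoincareDuality)
    {Z : Set X.left} (hZ : IsClosed Z) (hirr : IsIrreducible Z) :
    ∃ (d : ℕ) (Y : Motives.SchemeOver ℂ) (hY : Motives.IsSmoothProjective d Y) (g : Y ⟶ X),
      Order.height hirr.genericPoint = (d : ℕ∞) ∧ Set.range g.left.base = Z ∧
      ∀ b : ℕ, LinearMap.ker (complexBetti.restrictCompl X Z b).hom =
        ⨆ (a : ℕ) (hab : a + 2 * n = b + 2 * d), LinearMap.range (complexGysin μ hY hX g hab) := by
  -- the reduced closed subscheme `X₀ = closure {z}`, `z` the generic point of `Z`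
  set z : X.left := hirr.genericPoint with hz
  have hzZ : closure {z} = Z := hirr.closure_genericPoint hZ
  let X₀ : Motives.ClosedSubvariety X.left := Motives.ClosedSubvariety.ofPoint X.left z
  haveI : IsIntegral X₀.toSchemeOver.left := inferInstanceAs (IsIntegral X₀.carrier)
  obtain ⟨d, Y, π, hY, hπ, hdim⟩ := Resolution.Hironaka1964_projective_holds ℂ X₀.toSchemeOver
    (isProjectiveOver_toSchemeOver X₀ hX.isProjectiveOver)
  refine ⟨d, Y, hY, π ≫ X₀.ιOver, ?_, ?_, fun b ↦ ?_⟩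
  · -- `height z = height (generic point of X₀) = d`
    have e1 : X₀.ι.base (genericPoint X₀.carrier) = z :=
      Motives.ClosedSubvariety.genericPoint_ofPoint z
    have e2 : Order.height (X₀.ι.base (genericPoint X₀.carrier)) =
        Order.height (genericPoint X₀.carrier) :=
      Motives.Scheme.height_base_eq_of_isClosedImmersion _ _
    rw [← e1, e2]
    exact hdim
  · -- the image: `π` is onto and `X₀.ι` has image `closure {z} = Z`
    haveI : IsProper π.left := by
      haveI : IsProper Y.hom := Motives.IsSmoothProjective.isProper_holds hY
      haveI : IsProper X₀.toSchemeOver.hom := Motives.IsProjectiveOver.isProper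
        (isProjectiveOver_toSchemeOver X₀ hX.isProjectiveOver)
      have h : IsProper (π.left ≫ X₀.toSchemeOver.hom) := by
        rw [Over.w π]
        infer_instance
      exact MorphismProperty.of_postcomp (W := @IsProper) (W' := @IsSeparated) π.left
        X₀.toSchemeOver.hom inferInstance h
    have hsurj := surjective_base_of_isBirational π.left hπ
    rw [← hzZ, ← Motives.ClosedSubvariety.range_ofPoint_ι z]
    refine Set.Subset.antisymm ?_ fun w hw ↦ ?_
    · rintro _ ⟨y, rfl⟩
      exact ⟨_, rfl⟩
    · obtain ⟨v, rfl⟩ := hw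
      obtain ⟨y, rfl⟩ := hsurj v
      exact ⟨y, rfl⟩
  · -- Deligne's theorem for the single morphism `π ≫ X₀.ιOver`
    have h := Deligne1974_ker_restrictCompl_eq_iSup_range_complexGysin.ker_restrictCompl_range_eq
      (Deligne1974_ker_restrictCompl_eq_iSup_range_complexGysin_holds_of
        Deligne1974_ker_pullback_eq_ker_pullback_resolution_holds) μ hμ hX hY (π ≫ X₀.ιOver) b
    have hrange : Set.range (π ≫ X₀.ιOver).left.base = Z := by
      haveI : IsProper π.left := by
        haveI : IsProper Y.hom := Motives.IsSmoothProjective.isProper_holds hY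
        haveI : IsProper X₀.toSchemeOver.hom := Motives.IsProjectiveOver.isProper
          (isProjectiveOver_toSchemeOver X₀ hX.isProjectiveOver)
        have h : IsProper (π.left ≫ X₀.toSchemeOver.hom) := by
          rw [Over.w π]
          infer_instance
        exact MorphismProperty.of_postcomp (W := @IsProper) (W' := @IsSeparated) π.left
          X₀.toSchemeOver.hom inferInstance h
      have hsurj := surjective_base_of_isBirational π.left hπ
      rw [← hzZ, ← Motives.ClosedSubvariety.range_ofPoint_ι z]
      refine Set.Subset.antisymm ?_ fun w hw ↦ ?_
      · rintro _ ⟨y, rfl⟩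
        exact ⟨_, rfl⟩
      · obtain ⟨v, rfl⟩ := hw
        obtain ⟨y, rfl⟩ := hsurj v
        exact ⟨y, rfl⟩
    rw [hrange] at h
    exact h

/-- **Below the codimension, nothing is supported on `Z`**: for `Z ⊆ X` irreducible closed of
dimension `d` and `b < 2(n - d)`, `ker (Hᵇ(X(ℂ)) → Hᵇ((X ∖ Z)(ℂ))) = 0` (no Gysin morphism
`Hᵃ(Y) → Hᵇ(X)`, `a + 2n = b + 2d`, has `a ≥ 0`). [cite: DeligneHodgeIII1974, Cor. 8.2.8] -/
theorem ker_restrictCompl_eq_bot_of_lt (hX : Motives.IsSmoothProjective n X)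
    {Z : Set X.left} (hZ : IsClosed Z) (hirr : IsIrreducible Z) {d : ℕ}
    (hd : Order.height hirr.genericPoint = (d : ℕ∞)) {b : ℕ} (hb : b + 2 * d < 2 * n) :
    LinearMap.ker (complexBetti.restrictCompl X Z b).hom = ⊥ := by
  obtain ⟨μ, hμ⟩ := exists_orientationFamily_hasPoincareDuality
  obtain ⟨d', Y, hY, g, hd', -, hker⟩ := exists_resolution_ker_restrictCompl_eq hX μ hμ hZ hirr
  have hdd : d' = d := by
    rw [hd] at hd'
    exact_mod_cast hd'.symm
  subst hdd
  rw [hker b, eq_bot_iff]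
  refine iSup_le fun a ↦ iSup_le fun hab ↦ ?_
  exfalso
  omega

/-- **The classes supported on one subvariety in the critical degree form a line**: for `Z ⊆ X`
irreducible closed of dimension `d` and `d + e = n`,
`dim ker (H^{2e}(X(ℂ)) → H^{2e}((X ∖ Z)(ℂ))) ≤ 1` — it is the image of
`g_* : H⁰(Y(ℂ); ℂ) = ℂ → H^{2e}(X(ℂ))` for a resolution `Y → Z`, i.e. the line of the cycle class
of `Z`. [cite: DeligneHodgeIII1974, Cor. 8.2.8] [cite: Fulton1998, §19.1 Lemma 19.1.1] -/
theorem finrank_ker_restrictCompl_le_one (hX : Motives.IsSmoothProjective n X)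
    {Z : Set X.left} (hZ : IsClosed Z) (hirr : IsIrreducible Z) {d e : ℕ}
    (hd : Order.height hirr.genericPoint = (d : ℕ∞)) (hde : d + e = n) :
    Module.finrank ℂ ↥(LinearMap.ker (complexBetti.restrictCompl X Z (2 * e)).hom) ≤ 1 := by
  obtain ⟨μ, hμ⟩ := exists_orientationFamily_hasPoincareDuality
  obtain ⟨d', Y, hY, g, hd', -, hker⟩ := exists_resolution_ker_restrictCompl_eq hX μ hμ hZ hirr
  have hdd : d' = d := by
    rw [hd] at hd'
    exact_mod_cast hd'.symm
  subst hdd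
  haveI := finite_complexBetti hX (2 * e)
  haveI := finite_complexBetti hY 0
  have h0 : 0 + 2 * n = 2 * e + 2 * d' := by omega
  have hle : LinearMap.ker (complexBetti.restrictCompl X Z (2 * e)).hom ≤
      LinearMap.range (complexGysin μ hY hX g h0) := by
    rw [hker (2 * e)]
    refine iSup_le fun a ↦ iSup_le fun hab ↦ ?_
    obtain rfl : a = 0 := by omega
    exact le_rfl
  calc Module.finrank ℂ ↥(LinearMap.ker (complexBetti.restrictCompl X Z (2 * e)).hom)
      ≤ Module.finrank ℂ ↥(LinearMap.range (complexGysin μ hY hX g h0)) :=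
        Submodule.finrank_mono hle
    _ ≤ Module.finrank ℂ (complexBetti Y 0) := LinearMap.finrank_range_le _
    _ = 1 := by
        haveI := hY.pathConnectedSpace
        exact Literature.Topology.FourManifolds.ComplexProjectiveSpace.finrank_singularCohomology_zero

/-! ### Supported classes are sums of classes supported on irreducible subvarieties -/

/-- **A class dying off a closed `Z` of codimension `≥ 1` is a sum of classes each dying off ONE
irreducible closed subset of `Z`.** Proof: `Z = ⋃_j g_j(Y_j)` for resolutions of its components
(`exists_family_iUnion_range_eq`); by Deligne's Cor. 8.2.8 the class is a sum of Gysin images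
`(g_j)_* y_j`, and `(g_j)_* y_j` dies off the irreducible closed `g_j(Y_j) ⊆ Z`
(`restrictCompl_complexGysin_eq_zero`). [cite: DeligneHodgeIII1974, Cor. 8.2.8]
[cite: Kollar2007, Thm. 3.27] -/
theorem mem_iSup_ker_restrictCompl_irreducible (hX : Motives.IsSmoothProjective n X)
    {Z : Set X.left} (hZ : IsClosed Z) (hZ1 : ∀ z ∈ Z, (1 : ℕ∞) ≤ Order.coheight z) {b : ℕ}
    {x : complexBetti X b} (hx : complexBetti.restrictCompl X Z b x = 0) :
    x ∈ ⨆ (W : Set X.left) (_ : IsClosed W) (_ : IsIrreducible W) (_ : W ⊆ Z),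
      LinearMap.ker (complexBetti.restrictCompl X W b).hom := by
  obtain ⟨μ, hμ⟩ := exists_orientationFamily_hasPoincareDuality
  obtain ⟨ι, _, m, Y, hY, g, -, hU⟩ :=
    exists_family_iUnion_range_eq Resolution.Hironaka1964_projective_holds hX hZ hZ1
  have hx' : complexBetti.restrictCompl X (⋃ j, Set.range (g j).left.base) b x = 0 := by
    rw [hU]
    exact hx
  have hmem := Deligne1974_ker_restrictCompl_eq_iSup_range_complexGysin.mem_iSup_range
    (Deligne1974_ker_restrictCompl_eq_iSup_range_complexGysin_holds_of
      Deligne1974_ker_pullback_eq_ker_pullback_resolution_holds) μ hμ hX hY g hx'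
  suffices hle : (⨆ (j : ι) (a : ℕ) (hab : a + 2 * n = b + 2 * m j),
      LinearMap.range (complexGysin μ (hY j) hX (g j) hab)) ≤
      ⨆ (W : Set X.left) (_ : IsClosed W) (_ : IsIrreducible W) (_ : W ⊆ Z),
        LinearMap.ker (complexBetti.restrictCompl X W b).hom from hle hmem
  refine iSup_le fun j ↦ iSup_le fun a ↦ iSup_le fun hab ↦ ?_
  -- `im (g j)_* ≤ K_{g_j(Y_j)}`, and `g_j(Y_j)` is irreducible, closed, inside `Z`
  have hcl : IsClosed (Set.range (g j).left.base) := by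
    haveI := isProper_left_of_isSmoothProjective (hY j) hX (g j)
    exact (Scheme.Hom.isClosedMap (g j).left).isClosed_range
  have hir : IsIrreducible (Set.range (g j).left.base) := by
    haveI := irreducibleSpace_of_isSmoothProjective' (hY j)
    rw [← Set.image_univ]
    exact (IrreducibleSpace.isIrreducible_univ _).image _ (g j).left.base.hom.continuous.continuousOn
  have hsub : Set.range (g j).left.base ⊆ Z :=
    hU ▸ Set.subset_iUnion (fun j ↦ Set.range (g j).left.base) j
  refine le_trans ?_ (le_iSup₂_of_le (Set.range (g j).left.base) hcl
    (le_iSup₂_of_le hir hsub le_rfl))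
  rintro _ ⟨y, rfl⟩
  exact restrictCompl_complexGysin_eq_zero (gysinMap_restrictCompl_eq_zero_of_field ℂ) μ hμ hX
    (hY j) (g j) hcl subset_rfl hab y

/-- **Coniveau is generated by irreducible supports**: for `r ≥ 1`,
`Nʳ Hⁱ(X(ℂ); ℂ) = Σ_{Z ⊆ X irreducible closed, codim ≥ r} ker (Hⁱ(X(ℂ)) → Hⁱ((X ∖ Z)(ℂ)))`.
[cite: DeligneHodgeIII1974, Cor. 8.2.8] [cite: GrothendieckTopology1969, §1] -/
theorem supportedClasses_eq_iSup_irreducible (hX : Motives.IsSmoothProjective n X) (i r : ℕ)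
    (hr : 1 ≤ r) :
    supportedClasses X i r = ⨆ (Z : Set X.left) (_ : IsClosed Z) (_ : IsIrreducible Z)
      (_ : ∀ z ∈ Z, (r : ℕ∞) ≤ Order.coheight z),
        LinearMap.ker (complexBetti.restrictCompl X Z i).hom := by
  refine le_antisymm (fun x hx ↦ ?_) ?_
  · obtain ⟨Z, hZ, hrZ, hxZ⟩ := exists_isClosed_of_mem_supportedClasses hx
    have hZ1 : ∀ z ∈ Z, (1 : ℕ∞) ≤ Order.coheight z := fun z hz ↦
      le_trans (by exact_mod_cast hr) (hrZ z hz)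
    suffices hle : (⨆ (W : Set X.left) (_ : IsClosed W) (_ : IsIrreducible W) (_ : W ⊆ Z),
        LinearMap.ker (complexBetti.restrictCompl X W i).hom) ≤
        ⨆ (Z : Set X.left) (_ : IsClosed Z) (_ : IsIrreducible Z)
          (_ : ∀ z ∈ Z, (r : ℕ∞) ≤ Order.coheight z),
            LinearMap.ker (complexBetti.restrictCompl X Z i).hom from
      hle (mem_iSup_ker_restrictCompl_irreducible hX hZ hZ1 hxZ)
    refine iSup_le fun W ↦ iSup_le fun hW ↦ iSup_le fun hWi ↦ iSup_le fun hWZ ↦ ?_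
    exact le_iSup₂_of_le W hW (le_iSup₂_of_le hWi (fun z hz ↦ hrZ z (hWZ hz)) le_rfl)
  · refine iSup_le fun Z ↦ iSup_le fun hZ ↦ iSup_le fun _ ↦ iSup_le fun hrZ ↦ ?_
    exact le_iSup₂_of_le Z hZ (le_iSup_of_le hrZ le_rfl)

/-- **On a smooth projective surface with `p_g = 0`, `H²(X(ℂ); ℂ)` is the sum of the lines of
classes supported on the irreducible closed subsets of codimension `≥ 1`** (curves and points; the
points contribute `0`, `ker_restrictCompl_eq_bot_of_lt`, and each curve at most a line,
`finrank_ker_restrictCompl_le_one`): Lefschetz `(1,1)` with `p_g = 0`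
(`algebraicClasses_one_eq_top_of_pg_zero lefschetzOneOne_rational_holds`) and
`supportedClasses_eq_iSup_irreducible`. [cite: Arapura2022, proof of Cor. 1.5 (p. 5)]
[cite: VoisinHodgeI2002, Thm. 11.30] [cite: DeligneHodgeIII1974, Cor. 8.2.8] -/
theorem top_eq_iSup_ker_restrictCompl_of_pg_zero (hX : Motives.IsSmoothProjective 2 X)
    (hpg : ∃ A : HodgeModel 2 X, Module.finrank ℂ ↥(A.hodgePQ 2 2 0) = 0) :
    (⊤ : Submodule ℂ (complexBetti X (2 * 1))) =
      ⨆ (Z : Set X.left) (_ : IsClosed Z) (_ : IsIrreducible Z)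
        (_ : ∀ z ∈ Z, (1 : ℕ∞) ≤ Order.coheight z),
          LinearMap.ker (complexBetti.restrictCompl X Z (2 * 1)).hom := by
  rw [← algebraicClasses_one_eq_top_of_pg_zero lefschetzOneOne_rational_holds hX hpg]
  exact supportedClasses_eq_iSup_irreducible hX (2 * 1) 1 le_rfl

/-- **Spanning criterion on a `p_g = 0` surface.** A subspace `W ⊆ H²(X(ℂ); ℂ)` containing, for
every irreducible closed `Z ⊆ X` of codimension `≥ 1` with `K_Z ≠ 0`, some NON-ZERO class dying off
`Z`, is everything: each `K_Z` is at most a line (`finrank_ker_restrictCompl_le_one`,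
`ker_restrictCompl_eq_bot_of_lt`), so `K_Z ⊆ W`, and the `K_Z` span
(`top_eq_iSup_ker_restrictCompl_of_pg_zero`). [cite: Arapura2022, proof of Cor. 1.5 (p. 5)] -/
theorem eq_top_of_forall_exists_mem_ker_restrictCompl (hX : Motives.IsSmoothProjective 2 X)
    (hpg : ∃ A : HodgeModel 2 X, Module.finrank ℂ ↥(A.hodgePQ 2 2 0) = 0)
    (W : Submodule ℂ (complexBetti X (2 * 1)))
    (hW : ∀ (Z : Set X.left), IsClosed Z → IsIrreducible Z →
      (∀ z ∈ Z, (1 : ℕ∞) ≤ Order.coheight z) →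
      LinearMap.ker (complexBetti.restrictCompl X Z (2 * 1)).hom ≠ ⊥ →
      ∃ x ∈ W, x ≠ 0 ∧ complexBetti.restrictCompl X Z (2 * 1) x = 0) :
    W = ⊤ := by
  rw [eq_top_iff, top_eq_iSup_ker_restrictCompl_of_pg_zero hX hpg]
  refine iSup_le fun Z ↦ iSup_le fun hZ ↦ iSup_le fun hirr ↦ iSup_le fun hZ1 ↦ ?_
  by_cases hbot : LinearMap.ker (complexBetti.restrictCompl X Z (2 * 1)).hom = ⊥
  · rw [hbot]
    exact bot_le
  obtain ⟨x, hxW, hx0, hxZ⟩ := hW Z hZ hirr hZ1 hbot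
  -- `K_Z` is a line: the height of the generic point is `0` or `1` on a surface
  obtain ⟨a, c, ha, hc, hac⟩ := exists_height_eq_coheight_eq hX hirr.genericPoint
  have hc1 : (1 : ℕ∞) ≤ Order.coheight hirr.genericPoint :=
    hZ1 _ (hirr.isGenericPoint_genericPoint hZ).mem
  rw [hc] at hc1
  have hc1' : 1 ≤ c := by exact_mod_cast hc1
  have hfin : Module.finrank ℂ ↥(LinearMap.ker (complexBetti.restrictCompl X Z (2 * 1)).hom) ≤ 1 := by
    rcases Nat.lt_or_ge a 1 with ha0 | ha1
    · -- a point: the kernel vanishes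
      obtain rfl : a = 0 := by omega
      rw [ker_restrictCompl_eq_bot_of_lt hX hZ hirr ha (by omega), finrank_bot]
      exact zero_le_one
    · obtain rfl : a = 1 := by omega
      exact finrank_ker_restrictCompl_le_one hX hZ hirr ha (e := 1) (by omega)
  -- a non-zero vector of `W` spans the line `K_Z`
  haveI := finite_complexBetti hX (2 * 1)
  have hxK : x ∈ LinearMap.ker (complexBetti.restrictCompl X Z (2 * 1)).hom := hxZ
  have hspan : LinearMap.ker (complexBetti.restrictCompl X Z (2 * 1)).hom = ℂ ∙ x := by
    refine (Submodule.eq_of_le_of_finrank_le (Submodule.span_le.2 (Set.singleton_subset_iff.2 hxK))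
      ?_).symm
    rw [finrank_span_singleton hx0]
    exact hfin
  rw [hspan]
  exact (Submodule.span_singleton_le_iff_mem x W).2 hxW

end HodgeTheory

end Literature.AlgebraicGeometry.HodgeTheory

end
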